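import Mathlib
import Summits.Ventures.HodgeRepro2.T5StarOfInvolution
import Summits.Ventures.HodgeRepro2.T5UnramifiedUniformiser
import Summits.Ventures.HodgeRepro2.T5UnitaryThreeHecke

/-!
# The inert-place Hecke package for `U(2,1)` under the Galois reading

Blind cell `pub-hodge-repro2`, seat p8 (gen 13), Tier-5 kernel support.  `T5CartanUnitaryThree`
(p402028) and `T5UnitaryThreeHecke` (p402251) prove the Cartan decomposition of
`U(antidiag(1, u, 1))` and the commutativity / multiplicity one / adjointness of its spherical
Hecke algebra for an abstract DVR `R ⊆ E` with a star preserving `R`-integrality, a star-fixed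
unit `u` and a star-fixed uniformiser `ϖ`.  This file instantiates those hypotheses from the
record's objects — the «identification of the record's local objects with the kernel's» that
stayed prose in CHECK-N3 §22.1:

* `F` = the base local field, `R₀` = its ring of integers (a DVR with fraction field `F`);
* `E / F` = the quadratic extension, `τ` = its Galois conjugation (an involutive
  `F`-automorphism; `T5StarOfInvolution.starRingOfInvolution` makes it the star);
* `𝒪_E := integralClosure R₀ E` = the ring of integers of `E` (a DVR — or merely LOCAL, for
  `E / F` separable, by `T5UnramifiedUniformiser.isDiscreteValuationRing_integralClosure`);
* `e = 1`: `𝔭_{R₀} 𝒪_E = 𝔭_{𝒪_E}` (the inert place is unramified);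
* `u ∈ R₀ˣ` the anisotropic coefficient and `ϖ ∈ R₀` a uniformiser of `F`.

Main statements: `isCartanDecomposition_galois`, `heckeAlgebra_mul_comm_galois`,
`finrank_invariants_eq_one_galois`, `ncard_orbit_inv_eq_galois`,
`apply_heckeSMul_doubleCosetOp_eq_inv_galois`, and the `_of_isLocalRing` forms where the
DVR hypothesis on `𝒪_E` is replaced by locality.  What stays a reading: that the record's
hermitian space has a self-dual basis with Gram matrix `antidiag(1, u, 1)` at the inert place,
and that the residue field is finite (an instance argument).

README §8(d): uses an L-value-free non-vanishing device: NO.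
-/

namespace Summit.Ventures.HodgeRepro2.T5GaloisCartanThree

open IsLocalRing IsLocalization T5StarOfInvolution T5UnramifiedUniformiser

variable {R₀ F E : Type*} [CommRing R₀] [IsDomain R₀] [IsDiscreteValuationRing R₀] [Field F]
  [Field E] [Algebra R₀ F] [IsFractionRing R₀ F] [Algebra F E] [Algebra R₀ E]
  [IsScalarTower R₀ F E] [FiniteDimensional F E]

section Units

omit [FiniteDimensional F E] in
include F in
/-- The image in `E` of a unit of `R₀` is non-zero. -/
theorem algebraMap_unit_ne_zero (u : R₀ˣ) : algebraMap R₀ E (u : R₀) ≠ 0 :=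
  (map_ne_zero_iff _ (algebraMap_injective R₀ F E)).mpr u.ne_zero

omit [IsDomain R₀] [IsDiscreteValuationRing R₀] [FiniteDimensional F E] in
include F in
/-- The image in `E` through `𝒪_E` of a non-zero element of `R₀` is non-zero. -/
theorem algebraMap_algebraMap_ne_zero {ϖ : R₀} (hϖ : ϖ ≠ 0) :
    algebraMap (integralClosure R₀ E) E (algebraMap R₀ (integralClosure R₀ E) ϖ) ≠ 0 := by
  rw [← IsScalarTower.algebraMap_apply]
  exact (map_ne_zero_iff _ (algebraMap_injective R₀ F E)).mpr hϖ

omit [IsDomain R₀] [IsDiscreteValuationRing R₀] in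
/-- The image in `E` of an element of `R₀` is `𝒪_E`-integral. -/
theorem isInteger_algebraMap (r : R₀) : IsInteger (integralClosure R₀ E) (algebraMap R₀ E r) :=
  (isInteger_integralClosure_iff _).mpr ((mem_integralClosure_iff _ _).mpr isIntegral_algebraMap)

omit [IsDomain R₀] [IsDiscreteValuationRing R₀] in
/-- The inverse of the image of a unit of `R₀` is `𝒪_E`-integral. -/
theorem isInteger_algebraMap_unit_inv (u : R₀ˣ) :
    IsInteger (integralClosure R₀ E) (algebraMap R₀ E (u : R₀))⁻¹ := by
  rw [← map_units_inv]
  exact isInteger_algebraMap ((u⁻¹ : R₀ˣ) : R₀)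

end Units

section Uniformiser

variable [IsDiscreteValuationRing (integralClosure R₀ E)]

omit [IsFractionRing R₀ F] [FiniteDimensional F E] in
/-- `e = 1` ⇒ a uniformiser of `R₀` is a uniformiser of `𝒪_E`. -/
theorem irreducible_uniformiser
    (hunr : (maximalIdeal R₀).map (algebraMap R₀ (integralClosure R₀ E)) =
      maximalIdeal (integralClosure R₀ E)) {ϖ : R₀} (hϖ : Irreducible ϖ) :
    Irreducible (algebraMap R₀ (integralClosure R₀ E) ϖ) :=
  irreducible_algebraMap_of_map_eq hunr hϖ

end Uniformiser

section Main

variable (τ : E ≃ₐ[F] E) (hτ : ∀ x, τ (τ x) = x)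
variable [IsDiscreteValuationRing (integralClosure R₀ E)]

/-- **The Cartan decomposition of the record's `U(2,1)` at an inert place, from the Galois
reading**: `𝒪_E = integralClosure R₀ E` a DVR, `e = 1`, the star the Galois conjugation `τ`,
`u ∈ R₀ˣ`, `ϖ ∈ R₀` a uniformiser of `F`. -/
theorem isCartanDecomposition_galois
    (hunr : (maximalIdeal R₀).map (algebraMap R₀ (integralClosure R₀ E)) =
      maximalIdeal (integralClosure R₀ E)) (u : R₀ˣ) {ϖ : R₀} (hϖ : Irreducible ϖ) :
    letI := starRingOfInvolution (τ : E ≃+* E) hτ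
    T5UnitaryHeckeAdjoint.IsCartanDecomposition (integralClosure R₀ E)
      (T5HermitianThreeElements.J3 (algebraMap R₀ E (u : R₀))) Fin.revPerm
      (Units.mk0 (algebraMap (integralClosure R₀ E) E (algebraMap R₀ (integralClosure R₀ E) ϖ))
        (algebraMap_algebraMap_ne_zero (F := F) hϖ.ne_zero)) := by
  letI := starRingOfInvolution (τ : E ≃+* E) hτ
  haveI : IsFractionRing (integralClosure R₀ E) E :=
    integralClosure.isFractionRing_of_finite_extension F E
  exact T5CartanUnitaryThree.isCartanDecomposition_three
    (fun x hx => isInteger_integralClosure_star τ hτ x hx) (algebraMap R₀ E (u : R₀))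
    (star_algebraMap_base τ hτ (u : R₀)) (algebraMap_unit_ne_zero (F := F) u) (isInteger_algebraMap (u : R₀))
    (isInteger_algebraMap_unit_inv u) (algebraMap R₀ (integralClosure R₀ E) ϖ)
    (irreducible_uniformiser hunr hϖ) (star_algebraMap_integralClosure τ hτ ϖ)

variable [Finite (ResidueField (integralClosure R₀ E))]

/-- **`H(U(2,1), K)` is commutative under the Galois reading** (`e = 1`, the star the Galois
conjugation, `u ∈ R₀ˣ`, finite residue field). -/
theorem heckeAlgebra_mul_comm_galois
    (hunr : (maximalIdeal R₀).map (algebraMap R₀ (integralClosure R₀ E)) =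
      maximalIdeal (integralClosure R₀ E)) (u : R₀ˣ) (k : Type*) [Field k] :
    letI := starRingOfInvolution (τ : E ≃+* E) hτ
    ∀ T S : T5HeckePermutationModule.heckeAlgebra k (T5UnitaryHeckeAdjoint.hyperspecialSubgroup
      (integralClosure R₀ E) (T5HermitianThreeElements.J3 (algebraMap R₀ E (u : R₀)))),
      T * S = S * T := by
  letI := starRingOfInvolution (τ : E ≃+* E) hτ
  haveI : IsFractionRing (integralClosure R₀ E) E :=
    integralClosure.isFractionRing_of_finite_extension F E
  obtain ⟨ϖ, hϖ⟩ := IsDiscreteValuationRing.exists_irreducible R₀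
  exact T5CartanUnitaryThree.heckeAlgebra_mul_comm_three
    (fun x hx => isInteger_integralClosure_star τ hτ x hx) (algebraMap R₀ E (u : R₀))
    (star_algebraMap_base τ hτ (u : R₀)) (algebraMap_unit_ne_zero (F := F) u) (isInteger_algebraMap (u : R₀))
    (isInteger_algebraMap_unit_inv u) (algebraMap R₀ (integralClosure R₀ E) ϖ)
    (irreducible_uniformiser hunr hϖ) (star_algebraMap_integralClosure τ hτ ϖ) k

/-- **Spherical multiplicity one for the record's `U(2,1)` under the Galois reading.** -/
theorem finrank_invariants_eq_one_galois
    (hunr : (maximalIdeal R₀).map (algebraMap R₀ (integralClosure R₀ E)) =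
      maximalIdeal (integralClosure R₀ E)) (u : R₀ˣ) {k : Type*} [Field k] [CharZero k]
    [IsAlgClosed k] {V : Type*} [AddCommGroup V] [Module k V] :
    letI := starRingOfInvolution (τ : E ≃+* E) hτ
    ∀ (ρ : Representation k (T5UnitaryGroupForm.formUnitaryGroup
      (T5HermitianThreeElements.J3 (algebraMap R₀ E (u : R₀)))) V) [ρ.IsIrreducible],
      T5LevelIdempotent.KFinite ρ (T5UnitaryHeckeAdjoint.hyperspecialSubgroup (integralClosure R₀ E)
        (T5HermitianThreeElements.J3 (algebraMap R₀ E (u : R₀)))) →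
      ∀ [FiniteDimensional k (LevelPositivity.invariants ρ (T5UnitaryHeckeAdjoint.hyperspecialSubgroup
        (integralClosure R₀ E) (T5HermitianThreeElements.J3 (algebraMap R₀ E (u : R₀)))))],
      LevelPositivity.invariants ρ (T5UnitaryHeckeAdjoint.hyperspecialSubgroup (integralClosure R₀ E)
        (T5HermitianThreeElements.J3 (algebraMap R₀ E (u : R₀)))) ≠ ⊥ →
      Module.finrank k (LevelPositivity.invariants ρ (T5UnitaryHeckeAdjoint.hyperspecialSubgroup
        (integralClosure R₀ E) (T5HermitianThreeElements.J3 (algebraMap R₀ E (u : R₀))))) = 1 := by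
  letI := starRingOfInvolution (τ : E ≃+* E) hτ
  haveI : IsFractionRing (integralClosure R₀ E) E :=
    integralClosure.isFractionRing_of_finite_extension F E
  obtain ⟨ϖ, hϖ⟩ := IsDiscreteValuationRing.exists_irreducible R₀
  intro ρ _ hK _ hne
  exact T5UnitaryThreeHecke.finrank_invariants_eq_one_three
    (fun x hx => isInteger_integralClosure_star τ hτ x hx) (algebraMap R₀ E (u : R₀))
    (star_algebraMap_base τ hτ (u : R₀)) (algebraMap_unit_ne_zero (F := F) u) (isInteger_algebraMap (u : R₀))
    (isInteger_algebraMap_unit_inv u) (algebraMap R₀ (integralClosure R₀ E) ϖ)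
    (irreducible_uniformiser hunr hϖ) (star_algebraMap_integralClosure τ hτ ϖ) ρ hK hne

omit [Finite (ResidueField (integralClosure R₀ E))] in
/-- `#(K g⁻¹ K / K) = #(K g K / K)` under the Galois reading. -/
theorem ncard_orbit_inv_eq_galois
    (hunr : (maximalIdeal R₀).map (algebraMap R₀ (integralClosure R₀ E)) =
      maximalIdeal (integralClosure R₀ E)) (u : R₀ˣ) :
    letI := starRingOfInvolution (τ : E ≃+* E) hτ
    ∀ g : T5UnitaryGroupForm.formUnitaryGroup
      (T5HermitianThreeElements.J3 (algebraMap R₀ E (u : R₀))),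
      (MulAction.orbit (T5UnitaryHeckeAdjoint.hyperspecialSubgroup (integralClosure R₀ E)
        (T5HermitianThreeElements.J3 (algebraMap R₀ E (u : R₀))))
        (QuotientGroup.mk g⁻¹ : _ ⧸ T5UnitaryHeckeAdjoint.hyperspecialSubgroup (integralClosure R₀ E)
          (T5HermitianThreeElements.J3 (algebraMap R₀ E (u : R₀))))).ncard =
      (MulAction.orbit (T5UnitaryHeckeAdjoint.hyperspecialSubgroup (integralClosure R₀ E)
        (T5HermitianThreeElements.J3 (algebraMap R₀ E (u : R₀))))
        (QuotientGroup.mk g : _ ⧸ T5UnitaryHeckeAdjoint.hyperspecialSubgroup (integralClosure R₀ E)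
          (T5HermitianThreeElements.J3 (algebraMap R₀ E (u : R₀))))).ncard := by
  letI := starRingOfInvolution (τ : E ≃+* E) hτ
  haveI : IsFractionRing (integralClosure R₀ E) E :=
    integralClosure.isFractionRing_of_finite_extension F E
  obtain ⟨ϖ, hϖ⟩ := IsDiscreteValuationRing.exists_irreducible R₀
  exact T5UnitaryThreeHecke.ncard_orbit_inv_eq_three
    (fun x hx => isInteger_integralClosure_star τ hτ x hx) (algebraMap R₀ E (u : R₀))
    (star_algebraMap_base τ hτ (u : R₀)) (algebraMap_unit_ne_zero (F := F) u) (isInteger_algebraMap (u : R₀))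
    (isInteger_algebraMap_unit_inv u) (algebraMap R₀ (integralClosure R₀ E) ϖ)
    (irreducible_uniformiser hunr hϖ) (star_algebraMap_integralClosure τ hτ ϖ)

/-- **Adjointness `B(T_g v, w) = B(v, T_{g⁻¹} w)` under the Galois reading.** -/
theorem apply_heckeSMul_doubleCosetOp_eq_inv_galois
    (hunr : (maximalIdeal R₀).map (algebraMap R₀ (integralClosure R₀ E)) =
      maximalIdeal (integralClosure R₀ E)) (u : R₀ˣ) {k : Type*} [Field k] [StarRing k]
    {V : Type*} [AddCommGroup V] [Module k V] :
    letI := starRingOfInvolution (τ : E ≃+* E) hτ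
    haveI : IsFractionRing (integralClosure R₀ E) E :=
      integralClosure.isFractionRing_of_finite_extension F E
    ∀ {ρ : Representation k (T5UnitaryGroupForm.formUnitaryGroup
        (T5HermitianThreeElements.J3 (algebraMap R₀ E (u : R₀)))) V}
      {B : V →ₗ⋆[k] V →ₗ[k] k}, T5HeckeAdjointHermitian.IsInvariantSesq ρ B →
      T5HeckeAdjointHermitian.IsHermitian B →
      ∀ (g : T5UnitaryGroupForm.formUnitaryGroup
          (T5HermitianThreeElements.J3 (algebraMap R₀ E (u : R₀))))
        (v w : LevelPositivity.invariants ρ (T5UnitaryHeckeAdjoint.hyperspecialSubgroup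
          (integralClosure R₀ E) (T5HermitianThreeElements.J3 (algebraMap R₀ E (u : R₀))))),
        B (T5HeckePermutationModule.heckeSMul ρ (T5HeckeDoubleCoset.doubleCosetOp k
          (T5UnitaryHeckeAdjoint.hyperspecialSubgroup (integralClosure R₀ E)
            (T5HermitianThreeElements.J3 (algebraMap R₀ E (u : R₀)))) g) v) w =
        B v (T5HeckePermutationModule.heckeSMul ρ (T5HeckeDoubleCoset.doubleCosetOp k
          (T5UnitaryHeckeAdjoint.hyperspecialSubgroup (integralClosure R₀ E)
            (T5HermitianThreeElements.J3 (algebraMap R₀ E (u : R₀)))) g⁻¹) w) := by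
  letI := starRingOfInvolution (τ : E ≃+* E) hτ
  haveI : IsFractionRing (integralClosure R₀ E) E :=
    integralClosure.isFractionRing_of_finite_extension F E
  obtain ⟨ϖ, hϖ⟩ := IsDiscreteValuationRing.exists_irreducible R₀
  intro ρ B hB hH g v w
  exact T5UnitaryThreeHecke.apply_heckeSMul_doubleCosetOp_eq_inv_three
    (fun x hx => isInteger_integralClosure_star τ hτ x hx) (algebraMap R₀ E (u : R₀))
    (star_algebraMap_base τ hτ (u : R₀)) (algebraMap_unit_ne_zero (F := F) u) (isInteger_algebraMap (u : R₀))
    (isInteger_algebraMap_unit_inv u) (algebraMap R₀ (integralClosure R₀ E) ϖ)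
    (irreducible_uniformiser hunr hϖ) (star_algebraMap_integralClosure τ hτ ϖ) hB hH g v w

end Main

section Local

variable (τ : E ≃ₐ[F] E) (hτ : ∀ x, τ (τ x) = x)
variable [Algebra.IsSeparable F E] [IsLocalRing (integralClosure R₀ E)]

/-- The Cartan decomposition with `𝒪_E` merely LOCAL (`E / F` separable): the DVR property
is `T5UnramifiedUniformiser.isDiscreteValuationRing_integralClosure`. -/
theorem isCartanDecomposition_galois_of_isLocalRing
    (hunr : (maximalIdeal R₀).map (algebraMap R₀ (integralClosure R₀ E)) =
      maximalIdeal (integralClosure R₀ E)) (u : R₀ˣ) {ϖ : R₀} (hϖ : Irreducible ϖ) :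
    letI := starRingOfInvolution (τ : E ≃+* E) hτ
    T5UnitaryHeckeAdjoint.IsCartanDecomposition (integralClosure R₀ E)
      (T5HermitianThreeElements.J3 (algebraMap R₀ E (u : R₀))) Fin.revPerm
      (Units.mk0 (algebraMap (integralClosure R₀ E) E (algebraMap R₀ (integralClosure R₀ E) ϖ))
        (algebraMap_algebraMap_ne_zero (F := F) hϖ.ne_zero)) := by
  haveI := isDiscreteValuationRing_integralClosure R₀ F E
  exact isCartanDecomposition_galois τ hτ hunr u hϖ

/-- `H(U(2,1), K)` commutative with `𝒪_E` merely LOCAL (`E / F` separable, finite residue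
field). -/
theorem heckeAlgebra_mul_comm_galois_of_isLocalRing [Finite (ResidueField (integralClosure R₀ E))]
    (hunr : (maximalIdeal R₀).map (algebraMap R₀ (integralClosure R₀ E)) =
      maximalIdeal (integralClosure R₀ E)) (u : R₀ˣ) (k : Type*) [Field k] :
    letI := starRingOfInvolution (τ : E ≃+* E) hτ
    ∀ T S : T5HeckePermutationModule.heckeAlgebra k (T5UnitaryHeckeAdjoint.hyperspecialSubgroup
      (integralClosure R₀ E) (T5HermitianThreeElements.J3 (algebraMap R₀ E (u : R₀)))),
      T * S = S * T := by
  haveI := isDiscreteValuationRing_integralClosure R₀ F E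
  exact heckeAlgebra_mul_comm_galois τ hτ hunr u k

end Local

end Summit.Ventures.HodgeRepro2.T5GaloisCartanThree
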